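import Literature.AlgebraicGeometry.Hironaka2017.PermissibleLSB
import Literature.AlgebraicGeometry.Resolution.RegularSubschemeLocallyIrreducible
import HarnessLib

/-!
# [OURS · L1 W4.6 rung (ii)] THE Γ-FREE SHADOW OF THE HOST ITEM, GLOBAL FORM — `IsPermissibleBlowupSeq` (Def. 2.4 without
# localisation) and `GammaFreeGlobalOrderReductionDimLeThree p` (statement-only typing; nesting + calibration)

Cell res-hironaka, LADDER-RESOLUTION rung L (D-0089), slot W4.6 «restricted-regime rungs of the typed Th. 16.6 procedure»,
rung (ii) (threefold hypersurfaces); typer res-L1-type-o1 (OURS typer o1, statement-only lane, G4). Host route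
MarkedTransfer, host item `HypersurfaceOrderReductionDimLeThree` (stmt-ResolutionOfSingularities-16156); this file is
proposed `--kind definition --supports` it. It answers OURS-desk #86 (lane A, res-ref-a2 2026-08-27T02:59:16Z): the
statement `CampaignW46.GammaFreeOrderReductionDimLeThree p` of `…ThreefoldsGammaFree.lean` (res-L1-s46-pv-3, p489219)
is VACUOUSLY TRUE, because the typed Def. 2.4 predicate `Hironaka2017.IsPermissibleLSB` has a constructor `restrict`
along ANY open immersion and the empty scheme is an open subscheme of everything: `X′ := ∅` witnesses
`∃ X′ Φ J′, IsPermissibleLSB I m Φ J′ ∧ ∀ x : X′, ord_x J′ < m` for every input.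

WHAT THIS FILE TYPES (nothing of the manuscript is asserted; every `def` is OURS):
* `CampaignW46.IsPermissibleBlowupSeq J b σ J′` — the LOCALISATION-FREE sub-predicate of Def. 2.4: `σ` is a finite
  composite of blowing-ups `Z′ = Z_r → Z_{r-1} → ⋯ → Z_0 = Z`, the `i`-th with a REGULAR centre `D_i ⊆ Sing(J_i, b) =
  {ξ | ord_ξ J_i ≥ b}` of the WHOLE stage `Z_i` (no passage to an open `U_i ⊂ Z_i`), `J_{i+1}` the controlled transform
  with exponent `b`, `J′ = J_r`. It is `IsPermissibleLSB` with the constructor `restrict` deleted and the two remaining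
  constructors' binders UNCHANGED (so the rung-(ii) kernel data — `CampaignW46.Step`: `D`, `centre.isRegular_subscheme`,
  `le_idealOrder_of_mem`, `blowup` — plug in verbatim); in the manuscript's words it is a «sequence of permissible
  blowups» (Rem. 2.6 p.6; «permissible» §2.1 p.4) as opposed to a LOCAL sequence (Def. 2.4 p.6). Anchors: `single`, `comp`,
  `toIsPermissibleLSB`, `isLocallyNoetherian_and_isRegular`, `isProper` (over a regular locally Noetherian base the
  composite is PROPER — blow-ups are proper, tree `IsBlowup.isProper`).
* `CampaignW46.GammaFreeGlobalOrderReductionDimLeThree p` — the bounced statement with `IsPermissibleBlowupSeq` in place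
  of `IsPermissibleLSB`, binders byte-identical (= stmt-16156's minus the boundary).
* CALIBRATION CORE (route-independent): a BGMW multiple blow-up `IsMultipleBlowup` is such a sequence
  (`isPermissibleBlowupSeq_of_isMultipleBlowup`, res-L1-s46-pv-3's Source-1 proof transported) and a marked resolution
  `IsMarkedResolution ⟨I, E, m⟩ Φ M′` yields `IsPermissibleBlowupSeq I m Φ M′.ideal ∧ ∀ x, ord_x M′.ideal < m`
  (`isPermissibleBlowupSeq_and_idealOrder_lt_of_isMarkedResolution`). The one-line consequence «host item stmt-16156 ⇒
  `GammaFreeGlobalOrderReductionDimLeThree p`» needs the route file and is filed as the LEAF companion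
  `…ThreefoldsGammaFreeGlobalCalibration.lean` (this module stays OUT of the Theses cone so that provers' closers may
  import it) — so the repaired statement is still WEAKER than the known case [CossartJannsenSaito2020,
  KawanoueMatsuki2016], never stronger. The global form trivially implies the bounced local form (`toIsPermissibleLSB`);
  not restated here to keep this module free of the bounced file's route import.

WHY THIS REPAIR (typer's call among the three shapes the lane named — localisation-free LSB / `Φ` proper-surjective /
Hironaka's local formulation): the rung-(ii) kernel chain that was meant to close the bounced statement
(`…ThreefoldsResolved.lean`: `Step.isPermissibleLSB` = `.single`, exhaustion `exists_isPermissibleLSB_sing_eq_empty` =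
`.nil`/`.comp`, `exists_isPermissibleLSB_hostState`; `…ThreefoldsStepExistsGeneral.lean`:
`exists_isPermissibleLSB_hostState_of_cover`) NEVER uses `restrict`: it builds exactly an `IsPermissibleBlowupSeq`. So the
global form is (1) what the kernel actually constructs, (2) closable by a verbatim transport of that chain (Source 2 —
a PROVER's file, not typed here), (3) the classical meaning of «order reduction of `(X, I, m)` by permissible blow-ups».
The proper-surjective shape is a CONSEQUENCE of the global form for the inputs at hand (blow-ups of integral schemes in
nowhere-dense centres are proper and birational, tree `IsBlowup.isProper`, `IsBlowup.isBirational'`) and is left to a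
prover if wanted; the local formulation is trivialised by the same empty witness unless it, too, drops `restrict`.

VACUITY / STRENGTH SELF-CHECK (typer): NOT trivially true — without `restrict` the only way to reach `X′ = ∅` is to blow
up a centre `D_i = Z_i` (the blow-up of the zero ideal of a reduced scheme is empty), and `D_i = Z_i` is never
permissible: `Z_0 = X` is integral and `I ≠ 0`, so `ord_η I = 0 < 1 ≤ m` at the generic point `η ∉ D_0`; inductively
every stage is the blow-up of an integral scheme along a nowhere-dense centre, again integral (tree
`IsBlowup.isIntegral`) with nonzero transform, and `Φ` is proper and surjective — truth of the statement requires order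
`< m` ABOVE EVERY POINT of `X`, i.e. genuine order reduction. NOT trivially false — it is implied by the host item
(calibration below), a published theorem in dimension ≤ 3. Degenerate slices disclosed: `topologicalKrullDim X ≤ 3`
includes curves and surfaces and points; `m = 1` asks for `J′ = 𝒪` (principalization-type conclusion).

AI-WRITTEN; NO expert review; AI review is weaker than expert review. H. Hironaka, ms. 2017-03-23, §2.1 p.4, Def. 2.1
p.5, Def. 2.4 p.6, Th. 16.13 p.87 — scope only, under adjudication, not cited as fact. [Hironaka2017]
References: `…ThreefoldsGammaFree.lean` (p489219, the bounced statement and its two sources — NOT imported: it imports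
the route file); tree `Hironaka2017.PermissibleLSB` (Def. 2.4 transcribed), `Resolution.MarkedIdeals` (`IsMultipleBlowup`,
`IsMarkedResolution` [BierstoneGrigorievMilmanWlodarczyk2011]), `Resolution.RegularSubschemeLocallyIrreducible`
(`eq_vanishingIdeal_support_of_isRegular`); route file `Theses/MarkedTransfer.lean` (stmt-16156) — not imported.
-/

noncomputable section

set_option linter.dupNamespace false -- mandated namespace of this single-conjunct summit

open CategoryTheory AlgebraicGeometry TopologicalSpace

namespace Summit.ResolutionOfSingularities.ResolutionOfSingularities.Theorems

namespace CampaignW46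

open Literature.AlgebraicGeometry.Resolution
open Scheme.IdealSheafData
open Literature.AlgebraicGeometry.Hironaka2017

universe u

/-! ## §0 The localisation-free sub-predicate of Def. 2.4: sequences of permissible blowing-ups -/

/-- [OURS · L1 W4.6 rung (ii)] replaces the role of «a (finite) sequence of permissible blowups for the ideal exponent
`E = (J, b)`» (the phrase of Rem. 2.6 p.6 l.3; «permissible» as in §2.1 p.4 l.38–39, transform as in Def. 2.1 p.5: each
`π_i : Z_{i+1} → Z_i` is the blowing up of the WHOLE stage `Z_i` with a regular centre `D_i ⊆ Sing(J_i, b) =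
{ξ | b ≤ ord_ξ J_i}` [printed: «closed smooth irreducible subscheme of Sing(E)»; irreducibility is not recorded, exactly as
in the typed Def. 2.4], `J_{i+1} = (J_i 𝒪_{Z_{i+1}} : 𝓘(π_i⁻¹ D_i)^b)` the controlled transform, `J′ = J_r` the last
transform) — i.e. Def. 2.4's LSB (p.6) with every `U_i = Z_i`; NOT a statement of the manuscript. Formally: the typed
`Hironaka2017.IsPermissibleLSB` with its constructor `restrict` DELETED and the binders of `nil` / `blowup` unchanged.
Every such sequence is an LSB (`toIsPermissibleLSB`); the converse fails (an LSB may localise, e.g. to the empty open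
subscheme — the vacuity of OURS-desk #86). [folklore] -/
inductive IsPermissibleBlowupSeq {Z : Scheme.{u}} (J : Z.IdealSheafData) (b : ℕ) :
    ∀ ⦃Z' : Scheme.{u}⦄, (Z' ⟶ Z) → Z'.IdealSheafData → Prop
  /-- the empty sequence: `Z_0 = Z`, `J_0 = J` -/
  | nil : IsPermissibleBlowupSeq J b (𝟙 Z) J
  /-- one more blowing up `π : Z_{i+1} → Z_i` of the whole stage with regular centre `D ⊆ Sing(J_i, b)`; `J_{i+1}` = the
  controlled transform with exponent `b` -/
  | blowup ⦃Z'' Z' : Scheme.{u}⦄ {σ : Z' ⟶ Z} {J' : Z'.IdealSheafData}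
      (h : IsPermissibleBlowupSeq J b σ J') (D : Closeds Z') (π : Z'' ⟶ Z')
      (hreg : Scheme.IsRegular (vanishingIdeal D).subscheme)
      (hD : ∀ y ∈ (D : Set Z'), (b : ℕ∞) ≤ idealOrder J' y)
      (hπ : IsBlowup π (vanishingIdeal D)) :
      IsPermissibleBlowupSeq J b (π ≫ σ) (controlledTransform π (vanishingIdeal D) J' b)

namespace IsPermissibleBlowupSeq

variable {Z : Scheme.{u}} {J : Z.IdealSheafData} {b : ℕ}

/-- A single permissible blowing up of the whole of `Z` is a sequence of permissible blowing-ups of length one.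
[folklore] -/
theorem single {Z' : Scheme.{u}} (D : Closeds Z) (π : Z' ⟶ Z)
    (hreg : Scheme.IsRegular (vanishingIdeal D).subscheme)
    (hD : ∀ y ∈ (D : Set Z), (b : ℕ∞) ≤ idealOrder J y) (hπ : IsBlowup π (vanishingIdeal D)) :
    IsPermissibleBlowupSeq J b π (controlledTransform π (vanishingIdeal D) J b) := by
  simpa using IsPermissibleBlowupSeq.blowup IsPermissibleBlowupSeq.nil D π hreg hD hπ

/-- **Composition**: a sequence of permissible blowing-ups over the last stage `Z′` of one for `(J, b)`, permissible for
the transform `(J′, b)`, composes to a sequence of permissible blowing-ups for `(J, b)` over `Z`. [folklore] -/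
theorem comp {Z' : Scheme.{u}} {σ : Z' ⟶ Z} {J' : Z'.IdealSheafData} (h₁ : IsPermissibleBlowupSeq J b σ J') :
    ∀ {Z'' : Scheme.{u}} {τ : Z'' ⟶ Z'} {J'' : Z''.IdealSheafData},
      IsPermissibleBlowupSeq J' b τ J'' → IsPermissibleBlowupSeq J b (τ ≫ σ) J'' := by
  intro Z'' τ J'' h₂
  induction h₂ with
  | nil => simpa using h₁
  | blowup h D π hreg hD hπ ih => simpa using ih.blowup D π hreg hD hπ

/-- **Every sequence of permissible blowing-ups is an `E`-permissible LSB of the typed Def. 2.4** (the one that never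
localises). [folklore] -/
theorem toIsPermissibleLSB :
    ∀ {Z' : Scheme.{u}} {σ : Z' ⟶ Z} {J' : Z'.IdealSheafData},
      IsPermissibleBlowupSeq J b σ J' → IsPermissibleLSB J b σ J' := by
  intro Z' σ J' h
  induction h with
  | nil => exact IsPermissibleLSB.nil
  | blowup h D π hreg hD hπ ih => exact ih.blowup D π hreg hD hπ

/-- All stages of a sequence of permissible blowing-ups over a regular locally Noetherian scheme are regular and locally
Noetherian (through `toIsPermissibleLSB` and the Def. 2.4 lemma). [cite: Liu2002, Thm. 8.1.19 (a)] -/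
theorem isLocallyNoetherian_and_isRegular {Z' : Scheme.{u}} {σ : Z' ⟶ Z} {J' : Z'.IdealSheafData}
    (h : IsPermissibleBlowupSeq J b σ J') (hN : IsLocallyNoetherian Z) (hR : Scheme.IsRegular Z) :
    IsLocallyNoetherian Z' ∧ Scheme.IsRegular Z' :=
  h.toIsPermissibleLSB.isLocallyNoetherian_and_isRegular hN hR

/-- **A sequence of permissible blowing-ups over a regular locally Noetherian scheme is a PROPER morphism** (each stage
is locally Noetherian, `isLocallyNoetherian_and_isRegular`; a blowing up of a locally Noetherian scheme is proper, tree
`IsBlowup.isProper` [Stacks 02NS]; proper morphisms compose). This is the «`Φ` proper onto `X`» half of the globality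
clause OURS-desk #86 lane B asked for, as a CONSEQUENCE of the localisation-free predicate (the empty open immersion of
the vacuous witness is proper too — it is surjectivity, i.e. integrality of the stages, that it lacks; not recorded
here). [cite: StacksProject, Tag 02NS] -/
theorem isProper :
    ∀ {Z' : Scheme.{u}} {σ : Z' ⟶ Z} {J' : Z'.IdealSheafData}, IsPermissibleBlowupSeq J b σ J' →
      IsLocallyNoetherian Z → Scheme.IsRegular Z → IsProper σ := by
  intro Z' σ J' h hN hR
  induction h with
  | nil => exact inferInstance
  | blowup h D π hreg hD hπ ih =>
    haveI : IsLocallyNoetherian _ := (h.isLocallyNoetherian_and_isRegular hN hR).1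
    haveI : IsProper π := hπ.isProper
    haveI := ih
    exact inferInstance

end IsPermissibleBlowupSeq

/-! ## §1 The Γ-free shadow of stmt-16156, global form -/

/-- [OURS · L1 W4.6 rung (ii)] replaces the role of «(ii) threefold hypersurfaces: the typed Th. 16.6 procedure
terminates — and reduces order — where MarkedTransfer `HypersurfaceOrderReductionDimLeThree` applies» as a statement
ABOUT THE INPUT `(X, I, m)`; NOT a statement of the manuscript. It SUPERSEDES the role of the vacuous
`GammaFreeOrderReductionDimLeThree p` (OURS-desk #86). Γ-FREE GLOBAL HYPERSURFACE ORDER REDUCTION IN DIMENSION `≤ 3` at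
the prime `p`: for every perfect field `k` of characteristic `p`, every separated, locally-of-finite-type, quasi-compact,
integral, regular `k`-scheme `X` with `topologicalKrullDim X ≤ 3`, every effective Cartier ideal `I ≠ 0` and every
`m ≥ 1`, there is a finite SEQUENCE OF PERMISSIBLE BLOWING-UPS `Φ : X′ → X` for `(I, m)` (`IsPermissibleBlowupSeq`: regular
centres inside the successive loci of order `≥ m` of the WHOLE stages, no localisation — the shape of the manuscript's own
resolution statements, Th. 16.13 / Th. 16.14 p.87 l.26–35 «a finite sequence of blowups of Z permissible for E … the
resolution means to make the singular locus empty», scope only) whose last transform `J′` has `ord_x J′ < m` at every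
point `x` of `X′`, i.e. `Sing(J′, m) = ∅`. Binders = stmt-16156's minus the boundary `E`/`HasSNC E`; conclusion =
16156's `IsMarkedResolution` minus boundary/snc bookkeeping (implied by it:
`isPermissibleBlowupSeq_and_idealOrder_lt_of_isMarkedResolution` here, and the leaf `…GammaFreeGlobalCalibration.lean`).
VACUITY: not trivially true (no `restrict`, so `X′ = ∅` would need a permissible centre equal to a whole integral stage,
excluded at the generic point by `ord_η = 0 < m`; `Φ` is then proper birational onto `X`), not trivially false (implied by
the host item). [folklore] -/
def GammaFreeGlobalOrderReductionDimLeThree (p : ℕ) : Prop :=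
  p.Prime → ∀ (k : Type u) [Field k] [CharP k p] [PerfectField k] (X : Scheme.{u}) (s : X ⟶ Spec (.of k)),
    IsSeparated s → LocallyOfFiniteType s → QuasiCompact s → IsIntegral X → Scheme.IsRegular X →
      topologicalKrullDim X ≤ 3 → ∀ (I : X.IdealSheafData), I ≠ ⊥ → IsEffectiveCartier I → ∀ (m : ℕ), 1 ≤ m →
        ∃ (X' : Scheme.{u}) (Φ : X' ⟶ X) (J' : X'.IdealSheafData),
          IsPermissibleBlowupSeq I m Φ J' ∧ ∀ x : X', idealOrder J' x < m

/-! ## §2 Calibration core (route-independent): marked resolutions are such sequences, ending below order `m` -/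

/-- **A multiple blow-up of marked ideals (BGMW Def. 3.1.3/3.1.4) is a sequence of permissible blowing-ups for
`(𝓘, μ)` with last transform the final ideal**, and the multiplicity is unchanged: each centre `V(C)` is a REGULAR closed
subscheme of the whole stage, so `C` is radical, `C = 𝓘(V(C))` (tree `eq_vanishingIdeal_support_of_isRegular`), it lies
in the support `{ord ≥ μ}`, and the transform is the controlled transform with exponent `μ` (res-L1-s46-pv-3's
`isPermissibleLSB_of_isMultipleBlowup`, transported to the localisation-free predicate — the BGMW sequence never
localises either). [folklore] -/
theorem isPermissibleBlowupSeq_of_isMultipleBlowup {X : Scheme.{u}} {M : MarkedIdeal X} :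
    ∀ {X' : Scheme.{u}} {σ : X' ⟶ X} {M' : MarkedIdeal X'}, IsMultipleBlowup M σ M' →
      IsPermissibleBlowupSeq M.ideal M.mult σ M'.ideal ∧ M'.mult = M.mult := by
  intro X' σ M' h
  induction h with
  | refl => exact ⟨IsPermissibleBlowupSeq.nil, rfl⟩
  | blowup h C τ hτ hC hsupp hsnc ih =>
    obtain ⟨ih1, ihm⟩ := ih
    refine ⟨?_, by simpa using ihm⟩
    have hCeq : C = Scheme.IdealSheafData.vanishingIdeal C.support := eq_vanishingIdeal_support_of_isRegular C hC
    have hreg : Scheme.IsRegular (Scheme.IdealSheafData.vanishingIdeal C.support).subscheme := by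
      rw [← hCeq]
      exact hC
    have hτ' : IsBlowup τ (Scheme.IdealSheafData.vanishingIdeal C.support) := by
      rw [← hCeq]
      exact hτ
    have key := IsPermissibleBlowupSeq.blowup ih1 C.support τ hreg (fun y hy => by
      have hy' := hsupp hy
      rw [← ihm]
      exact hy') hτ'
    rw [MarkedIdeal.transform_ideal, ihm]
    rw [← hCeq] at key
    exact key

/-- **CALIBRATION CORE: a marked resolution of `(I, E, m)` (BGMW Def. 3.1.3, the conclusion of the host item stmt-16156)
is a sequence of permissible blowing-ups for `(I, m)` whose last transform has order `< m` everywhere** (empty final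
support). With `E := []` (`hasSNC_nil_of_isRegular`) this is «host item ⇒ `GammaFreeGlobalOrderReductionDimLeThree p`»,
filed as the leaf `…ThreefoldsGammaFreeGlobalCalibration.lean`; so the repaired OURS statement is WEAKER than the known
case, never stronger. [folklore] -/
theorem isPermissibleBlowupSeq_and_idealOrder_lt_of_isMarkedResolution {X : Scheme.{u}} {I : X.IdealSheafData}
    {E : List X.IdealSheafData} {m : ℕ} {X' : Scheme.{u}} {Φ : X' ⟶ X} {M' : MarkedIdeal X'}
    (h : IsMarkedResolution (⟨I, E, m⟩ : MarkedIdeal X) Φ M') :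
    IsPermissibleBlowupSeq I m Φ M'.ideal ∧ ∀ x : X', idealOrder M'.ideal x < m := by
  obtain ⟨hmb, hsupp⟩ := h
  obtain ⟨hseq, hmult⟩ := isPermissibleBlowupSeq_of_isMultipleBlowup hmb
  refine ⟨hseq, fun x => ?_⟩
  have hx : x ∉ M'.support := by
    rw [hsupp]
    exact Set.notMem_empty x
  have hx' : ¬ ((M'.mult : ℕ∞) ≤ idealOrder M'.ideal x) := hx
  rw [hmult] at hx'
  exact not_le.mp hx'

end CampaignW46

end Summit.ResolutionOfSingularities.ResolutionOfSingularities.Theorems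

end
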